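import Summits.Parity.GeneralizedHardyLittlewood.Theorems.LeeYangFibresFibreHyperbolicityAlongDefs
import Summits.Parity.GeneralizedHardyLittlewood.Theorems.LeeYangFibresFibreHyperbolicityAlongMarginGeometryAux
import HarnessLib

/-!
# Route `LeeYangFibres`, crux `FibreHyperbolicityAlong` (stmt-Parity-18103), line
# `sifted-chowla-distillation`: MARGIN FROM ZERO GEOMETRY and the registered stub
# `stub_lobeMarginOfZeroGeometry : ModelZeroGeometry → ModelLobeMargin`

`MarginGeometry.margin_from_geometry` (pure real analysis, the corrected `MarginFromGaps` of the card
`dickman-dictionary-unit-gaps`): let `0 < a_0 < a_1 < ⋯ < a_{d-1}` with `a_0 ≤ B`, gaps `a_{i+1} - a_i ≥ 1`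
and NON-DECREASING, and `a_{d-1} ≤ e^{Bd}`.  Then along the `d + 1` test points `x_0 = 0`,
`x_k = -(a_{k-1} + a_k)/2` (`1 ≤ k ≤ d-1`), `x_d = -2a_{d-1}` the product `∏_{i<d} (x_k + a_i)` has sign
`(-1)^k` and
`e^{-(6+3B)d} · (∏_{i<d} (|x_k| + a_i) + |x_k|^{d+1}) < (-1)^k ∏_{i<d} (x_k + a_i)`.
Proof: with `m = |x_k|` (interior lobe `k = p + 1`, `d = p + 1 + N`) the per-factor bounds `below_factor` /
`above_factor` of the Aux file and the explicit products `prod_below_bound`, `prod_above_bound`,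
`numeric_bound` give the lobe ratio `≥ e^{-(2B+4d)}` (`interior_lobe`); the top lobe has every factor
`≥ 1/4` (`top_lobe`); `tol_le` and `lobe_finish` absorb the tolerance term and the constants.
Without monotone gaps the statement fails (gaps `G,1,1,…`), and without `a_0 ≤ B` it fails already in
degree 2 (`(X+A+1)(X+A+2)`, radius `≈ 1/(4A²)`): both hypotheses are necessary in kind.

Glue (`stub_lobeMarginOfZeroGeometry`, registered): if the row `modelPoly u = I_{u-1}(u) ∏_{i<u-2} (X + a_i)`
has this zero geometry for large `u` (`ModelZeroGeometry`, the corrected Conjecture G), then the lobe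
certificate `ModelLobeMargin` (hypothesis of `stub_robustRowOfLobeMargin`) holds with `C = 6 + 3B`.

-- adapted from work/stubs/RobustRowExpGeometry.lean (wave 1), helper `def testPoint` inlined.
-/

noncomputable section

namespace Summit.Parity.GeneralizedHardyLittlewood.Cruxes.FibreHyperbolicityAlong.SiftedChowlaDistillation

namespace MarginGeometry

open scoped BigOperators
open Finset

variable {d : ℕ} {a : ℕ → ℝ}

/-! ### Lobes -/

/-- Product of negated terms over `range n`. -/
theorem prod_range_neg (f : ℕ → ℝ) (n : ℕ) :
    ∏ i ∈ range n, (-f i) = (-1) ^ n * ∏ i ∈ range n, f i := by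
  induction n with
  | zero => simp
  | succ n ih => rw [prod_range_succ, prod_range_succ, ih]; ring

/-- Reflection of a product over `range (p+1)`. -/
theorem prod_range_reflect' (f : ℕ → ℝ) (p : ℕ) :
    ∏ n ∈ range (p + 1), f (p - n) = ∏ i ∈ range (p + 1), f i := by
  have h := Finset.prod_range_reflect f (p + 1)
  simpa using h

/-- INTERIOR lobe `k = p + 1`, `d = p + 1 + N`, `N ≥ 1`: with `m` the midpoint of `(a_p, a_{p+1})`,
`exp (-(2B + 4d)) ∏ (m + a_i) ≤ ∏_{n ≤ p} (m - a_{p-n}) · ∏_{n<N} (a_{p+1+n} - m)`. -/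
theorem interior_lobe {p N : ℕ} {a : ℕ → ℝ}
    (hgap : ∀ i : ℕ, i + 1 < p + 1 + N → 1 ≤ a (i + 1) - a i)
    (hmono : ∀ i : ℕ, i + 2 < p + 1 + N → a (i + 1) - a i ≤ a (i + 2) - a (i + 1))
    {B : ℕ} (ha0 : 0 < a 0) (haB : a 0 ≤ B) (hN : 1 ≤ N) :
    Real.exp (-(2 * (B : ℝ) + 4 * ((p + 1 + N : ℕ) : ℝ))) *
        ∏ i ∈ range (p + 1 + N), ((a p + a (p + 1)) / 2 + a i) ≤
      (∏ n ∈ range (p + 1), ((a p + a (p + 1)) / 2 - a (p - n))) *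
        ∏ n ∈ range N, (a (p + 1 + n) - (a p + a (p + 1)) / 2) := by
  set m := (a p + a (p + 1)) / 2 with hm
  have hapos : ∀ i : ℕ, i < p + 1 + N → 0 < a i := fun i hi => a_pos hgap ha0 hi
  have hmpos : 0 < m := by
    have h1 := hapos p (by omega)
    have h2 := hapos (p + 1) (by omega)
    rw [hm]; linarith
  have hMpos : (0 : ℝ) < ((B + p : ℕ) : ℝ) + 1 := by positivity
  have hB0 : (0 : ℝ) ≤ (B : ℝ) := Nat.cast_nonneg B
  -- termwise bounds
  have hbelow : ∀ n ∈ range (p + 1),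
      ((n : ℝ) + 1 / 2) / (2 * (((B + p : ℕ) : ℝ) + 1)) * (m + a (p - n)) ≤ m - a (p - n) := by
    intro n hn
    have hn' : n ≤ p := Nat.lt_succ_iff.mp (Finset.mem_range.mp hn)
    have h := below_factor hgap hmono hB0 haB (p := p) (n := n) (by omega) hn'
    rw [← hm] at h
    have e : 2 * ((B : ℝ) + p + 1) = 2 * (((B + p : ℕ) : ℝ) + 1) := by push_cast; ring
    rw [e] at h
    rw [div_mul_eq_mul_div, div_le_iff₀ (by positivity)]
    linarith
  have habove : ∀ n ∈ range N,
      ((n : ℝ) + 1 / 2) / (2 * (((B + p : ℕ) : ℝ) + 1 + n)) * (a (p + 1 + n) + m) ≤ a (p + 1 + n) - m := by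
    intro n hn
    have hn' : p + 1 + n < p + 1 + N := by have := Finset.mem_range.mp hn; omega
    have h := above_factor hgap hmono hB0 haB (p := p) (n := n) hn'
    rw [← hm] at h
    have e : 2 * ((B : ℝ) + p + 1 + n) = 2 * (((B + p : ℕ) : ℝ) + 1 + n) := by push_cast; ring
    rw [e] at h
    rw [div_mul_eq_mul_div, div_le_iff₀ (by positivity)]
    linarith
  -- products of the termwise bounds
  have hP1 : (∏ n ∈ range (p + 1), (((n : ℝ) + 1 / 2) / (2 * (((B + p : ℕ) : ℝ) + 1)))) *
      ∏ n ∈ range (p + 1), (m + a (p - n)) ≤ ∏ n ∈ range (p + 1), (m - a (p - n)) := by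
    rw [← Finset.prod_mul_distrib]
    refine Finset.prod_le_prod (fun n hn => mul_nonneg (by positivity) ?_) hbelow
    have := hapos (p - n) (by omega)
    linarith
  have hP2 : (∏ n ∈ range N, (((n : ℝ) + 1 / 2) / (2 * (((B + p : ℕ) : ℝ) + 1 + n)))) *
      ∏ n ∈ range N, (a (p + 1 + n) + m) ≤ ∏ n ∈ range N, (a (p + 1 + n) - m) := by
    rw [← Finset.prod_mul_distrib]
    refine Finset.prod_le_prod (fun n hn => mul_nonneg (by positivity) ?_) habove
    have := hapos (p + 1 + n) (by have := Finset.mem_range.mp hn; omega)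
    linarith
  have hB1 := prod_below_bound hMpos (p + 1)
  have hB2 := prod_above_bound (B + p) N
  have hnum := numeric_bound B p N
  -- split `D`
  have hD : ∏ i ∈ range (p + 1 + N), (m + a i) =
      (∏ n ∈ range (p + 1), (m + a (p - n))) * ∏ n ∈ range N, (a (p + 1 + n) + m) := by
    rw [Finset.prod_range_add, prod_range_reflect' (fun i => m + a i) p]
    congr 1
    exact Finset.prod_congr rfl fun n _ => by ring
  have hD2 : 0 ≤ ∏ n ∈ range N, (a (p + 1 + n) + m) :=
    Finset.prod_nonneg fun n hn => by
      have := hapos (p + 1 + n) (by have := Finset.mem_range.mp hn; omega); linarith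
  have hDpos : 0 ≤ ∏ i ∈ range (p + 1 + N), (m + a i) :=
    Finset.prod_nonneg fun i hi => by have := hapos i (Finset.mem_range.mp hi); linarith
  have hc1 : 0 ≤ Real.exp (-(((B + p : ℕ) : ℝ) + 1)) / 4 ^ (p + 1) := by positivity
  have hc2 : (0 : ℝ) ≤ 1 / (4 ^ N * 2 ^ (B + p + N)) := by positivity
  calc Real.exp (-(2 * (B : ℝ) + 4 * ((p + 1 + N : ℕ) : ℝ))) * ∏ i ∈ range (p + 1 + N), (m + a i)
      ≤ (Real.exp (-(((B + p : ℕ) : ℝ) + 1)) / 4 ^ (p + 1) * (1 / ((4 : ℝ) ^ N * 2 ^ (B + p + N)))) *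
          ∏ i ∈ range (p + 1 + N), (m + a i) := mul_le_mul_of_nonneg_right hnum hDpos
    _ ≤ ((∏ n ∈ range (p + 1), (((n : ℝ) + 1 / 2) / (2 * (((B + p : ℕ) : ℝ) + 1)))) *
          ∏ n ∈ range N, (((n : ℝ) + 1 / 2) / (2 * (((B + p : ℕ) : ℝ) + 1 + n)))) *
          ∏ i ∈ range (p + 1 + N), (m + a i) := by
        apply mul_le_mul_of_nonneg_right _ hDpos
        exact mul_le_mul hB1 hB2 hc2 (hc1.trans hB1)
    _ = ((∏ n ∈ range (p + 1), (((n : ℝ) + 1 / 2) / (2 * (((B + p : ℕ) : ℝ) + 1)))) *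
            ∏ n ∈ range (p + 1), (m + a (p - n))) *
          ((∏ n ∈ range N, (((n : ℝ) + 1 / 2) / (2 * (((B + p : ℕ) : ℝ) + 1 + n)))) *
            ∏ n ∈ range N, (a (p + 1 + n) + m)) := by
        rw [hD]; ring
    _ ≤ (∏ n ∈ range (p + 1), (m - a (p - n))) * ∏ n ∈ range N, (a (p + 1 + n) - m) := by
        apply mul_le_mul hP1 hP2 (mul_nonneg (Finset.prod_nonneg fun n _ => by positivity) hD2)
        exact Finset.prod_nonneg fun n hn => by
          have := hbelow n hn
          have h0 : 0 ≤ ((n : ℝ) + 1 / 2) / (2 * (((B + p : ℕ) : ℝ) + 1)) * (m + a (p - n)) :=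
            mul_nonneg (by positivity) (by have := hapos (p - n) (by omega); linarith)
          linarith

/-- TOP lobe (beyond the largest zero, test point `2 a_{d-1}`): every factor is `≥ 1/4`. -/
theorem top_lobe (hgap : ∀ i : ℕ, i + 1 < d → 1 ≤ a (i + 1) - a i) (ha0 : 0 < a 0) (hd : 1 ≤ d) (B : ℕ) :
    Real.exp (-(2 * (B : ℝ) + 4 * (d : ℝ))) * ∏ i ∈ range d, (2 * a (d - 1) + a i) ≤
      ∏ i ∈ range d, (2 * a (d - 1) - a i) := by
  have hterm : ∀ i ∈ range d, (1 / 4) * (2 * a (d - 1) + a i) ≤ 2 * a (d - 1) - a i := by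
    intro i hi
    have hi' := Finset.mem_range.mp hi
    have hle : a i ≤ a (d - 1) := a_le hgap (by omega) (by omega)
    have hpos : 0 < a i := a_pos hgap ha0 hi'
    linarith
  have hDpos : 0 ≤ ∏ i ∈ range d, (2 * a (d - 1) + a i) :=
    Finset.prod_nonneg fun i hi => by
      have := a_pos hgap ha0 (Finset.mem_range.mp hi)
      have := a_pos hgap ha0 (d := d) (i := d - 1) (by omega)
      linarith
  have hexp : Real.exp (-(2 * (B : ℝ) + 4 * (d : ℝ))) ≤ (1 / 4) ^ d := by
    have h := exp_neg_two_mul_le_one_div_four_pow d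
    rw [one_div_pow]
    refine le_trans ?_ h
    rw [Real.exp_le_exp]
    have : (0 : ℝ) ≤ B := Nat.cast_nonneg B
    have : (0 : ℝ) ≤ d := Nat.cast_nonneg d
    linarith
  calc Real.exp (-(2 * (B : ℝ) + 4 * (d : ℝ))) * ∏ i ∈ range d, (2 * a (d - 1) + a i)
      ≤ (1 / 4) ^ d * ∏ i ∈ range d, (2 * a (d - 1) + a i) := mul_le_mul_of_nonneg_right hexp hDpos
    _ = ∏ i ∈ range d, ((1 / 4) * (2 * a (d - 1) + a i)) := by
        rw [Finset.prod_mul_distrib, Finset.prod_const, Finset.card_range]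
    _ ≤ ∏ i ∈ range d, (2 * a (d - 1) - a i) :=
        Finset.prod_le_prod (fun i hi => by
          have := a_pos hgap ha0 (Finset.mem_range.mp hi)
          have := a_pos hgap ha0 (d := d) (i := d - 1) (by omega)
          positivity) hterm

/-! ### The theorem -/

/-- **Margin from zero geometry** (corrected `MarginFromGaps`): if `0 < a_0 ≤ B`, the gaps
`a_{i+1} - a_i` are `≥ 1` and non-decreasing, and `a_{d-1} ≤ e^{Bd}`, then along the `d + 1` test points
`x_0 = 0 > x_1 > ⋯ > x_d` (`x_k = -(a_{k-1} + a_k)/2` for `1 ≤ k < d`, `x_d = -2a_{d-1}`) the product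
`∏_{i<d} (x_k + a_i)` has sign `(-1)^k` and dominates `e^{-(6+3B)d} · (∏_{i<d} (|x_k| + a_i) + |x_k|^{d+1})`. -/
theorem margin_from_geometry (B d : ℕ) (hd : 1 ≤ d) (a : ℕ → ℝ) (ha0 : 0 < a 0) (haB : a 0 ≤ B)
    (hgap : ∀ i : ℕ, i + 1 < d → 1 ≤ a (i + 1) - a i)
    (hmono : ∀ i : ℕ, i + 2 < d → a (i + 1) - a i ≤ a (i + 2) - a (i + 1))
    (htop : a (d - 1) ≤ Real.exp (B * d)) :
    ∃ x : ℕ → ℝ, (∀ k : ℕ, k < d → x (k + 1) < x k) ∧ ∀ k : ℕ, k ≤ d →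
      Real.exp (-((6 + 3 * (B : ℝ)) * d)) * ((∏ i ∈ range d, (|x k| + a i)) + |x k| ^ (d + 1)) <
        (-1) ^ k * ∏ i ∈ range d, (x k + a i) := by
  have hapos : ∀ i : ℕ, i < d → 0 < a i := fun i hi => a_pos hgap ha0 hi
  -- the test points `x_0 = 0`, `x_k = -(a_{k-1} + a_k)/2` (`1 ≤ k < d`), `x_k = -2 a_{d-1}` (`k ≥ d`)
  set x : ℕ → ℝ := fun k => if k = 0 then 0 else if k < d then -((a (k - 1) + a k) / 2) else -(2 * a (d - 1))
    with hx
  have x_zero : x 0 = 0 := by simp [hx]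
  have x_mid : ∀ k : ℕ, k ≠ 0 → k < d → x k = -((a (k - 1) + a k) / 2) := fun k hk hkd => by
    simp [hx, hk, hkd]
  have x_top : ∀ k : ℕ, k ≠ 0 → ¬ k < d → x k = -(2 * a (d - 1)) := fun k hk hkd => by
    simp [hx, hk, hkd]
  refine ⟨x, fun k hk => ?_, fun k hk => ?_⟩
  · -- strict decrease of the test points
    rcases Nat.eq_zero_or_pos k with rfl | hkpos
    · show x 1 < x 0
      rw [x_zero]
      by_cases h1 : 1 < d
      · rw [x_mid 1 one_ne_zero h1, Nat.sub_self]
        have := hapos 0 hd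
        have := hapos 1 h1
        linarith
      · rw [x_top 1 one_ne_zero h1]
        have := hapos (d - 1) (by omega)
        linarith
    · rw [x_mid k (by omega) hk]
      by_cases h1 : k + 1 < d
      · rw [x_mid (k + 1) (by omega) h1, Nat.add_sub_cancel]
        have := a_lt hgap (show k - 1 < k + 1 by omega) h1
        linarith
      · rw [x_top (k + 1) (by omega) h1]
        have hkd : k = d - 1 := by omega
        subst hkd
        have := a_lt hgap (show d - 1 - 1 < d - 1 by omega) (by omega)
        have := hapos (d - 1) (by omega)
        linarith
  · -- the margin, lobe by lobe
    rcases Nat.eq_zero_or_pos k with rfl | hkpos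
    · -- `k = 0`: `x = 0`
      rw [x_zero, abs_zero, pow_zero, one_mul, zero_pow (by omega : d + 1 ≠ 0), add_zero]
      simp only [zero_add]
      have hD : 0 < ∏ i ∈ range d, a i := Finset.prod_pos fun i hi => hapos i (Finset.mem_range.mp hi)
      have hlt : Real.exp (-((6 + 3 * (B : ℝ)) * d)) < 1 := by
        rw [Real.exp_lt_one_iff]
        have : (1 : ℝ) ≤ d := by exact_mod_cast hd
        have : (0 : ℝ) ≤ B := Nat.cast_nonneg B
        nlinarith
      calc Real.exp (-((6 + 3 * (B : ℝ)) * d)) * ∏ i ∈ range d, a i < 1 * ∏ i ∈ range d, a i :=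
            mul_lt_mul_of_pos_right hlt hD
        _ = ∏ i ∈ range d, a i := one_mul _
    · by_cases hkd : k < d
      · -- interior lobe: `k = p + 1`, `d = p + 1 + N`, `N ≥ 1`
        obtain ⟨p, rfl⟩ : ∃ p, k = p + 1 := ⟨k - 1, by omega⟩
        obtain ⟨N, rfl⟩ : ∃ N, d = p + 1 + N := ⟨d - (p + 1), by omega⟩
        have hN : 1 ≤ N := by omega
        rw [x_mid (p + 1) (by omega) hkd, Nat.add_sub_cancel]
        set m := (a p + a (p + 1)) / 2 with hm
        have hmpos : 0 < m := by
          have := hapos p (by omega)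
          have := hapos (p + 1) (by omega)
          rw [hm]; linarith
        rw [abs_neg, abs_of_pos hmpos]
        have hsign : (-1 : ℝ) ^ (p + 1) * ∏ i ∈ range (p + 1 + N), (-m + a i) =
            (∏ n ∈ range (p + 1), (m - a (p - n))) * ∏ n ∈ range N, (a (p + 1 + n) - m) := by
          have e0 : ∏ i ∈ range (p + 1), (-m + a i) = ∏ n ∈ range (p + 1), (-(m - a (p - n))) := by
            rw [← prod_range_reflect' (fun i => -m + a i) p]
            exact Finset.prod_congr rfl fun n _ => by ring
          have e2 : ∏ n ∈ range N, (-m + a (p + 1 + n)) = ∏ n ∈ range N, (a (p + 1 + n) - m) :=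
            Finset.prod_congr rfl fun n _ => by ring
          rw [Finset.prod_range_add, e0, prod_range_neg, e2]
          have hsq : ((-1 : ℝ) ^ (p + 1)) * ((-1 : ℝ) ^ (p + 1)) = 1 := by
            rw [← pow_add, ← two_mul, pow_mul]; norm_num
          calc (-1 : ℝ) ^ (p + 1) * ((-1) ^ (p + 1) * (∏ n ∈ range (p + 1), (m - a (p - n))) *
                ∏ n ∈ range N, (a (p + 1 + n) - m))
              = ((-1 : ℝ) ^ (p + 1) * (-1) ^ (p + 1)) *
                  ((∏ n ∈ range (p + 1), (m - a (p - n))) * ∏ n ∈ range N, (a (p + 1 + n) - m)) := by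
                ring
            _ = (∏ n ∈ range (p + 1), (m - a (p - n))) * ∏ n ∈ range N, (a (p + 1 + n) - m) := by
                rw [hsq, one_mul]
        rw [hsign]
        have hmain := interior_lobe hgap hmono ha0 haB hN (B := B)
        rw [← hm] at hmain
        refine lobe_finish (B := B) (by omega) ?_ ?_ (tol_le hmpos.le hapos) hmain
        · exact Finset.prod_pos fun i hi => by
            have := hapos i (Finset.mem_range.mp hi); linarith
        · have h1 : a p ≤ a (p + 1 + N - 1) := a_le hgap (by omega) (by omega)
          have h2 : a (p + 1) ≤ a (p + 1 + N - 1) := a_le hgap (by omega) (by omega)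
          have h3 : (0 : ℝ) ≤ Real.exp ((B : ℝ) * ((p + 1 + N : ℕ) : ℝ)) := (Real.exp_pos _).le
          rw [hm]
          linarith
      · -- top lobe: `k = d`, `x = -2 a_{d-1}`
        have hkd' : k = d := le_antisymm hk (not_lt.mp hkd)
        rw [hkd'] at hkd ⊢
        rw [x_top d (by omega) hkd]
        set m := 2 * a (d - 1) with hm
        have hmpos : 0 < m := by
          have := hapos (d - 1) (by omega)
          rw [hm]; linarith
        rw [abs_neg, abs_of_pos hmpos]
        have hsign : (-1 : ℝ) ^ d * ∏ i ∈ range d, (-m + a i) = ∏ i ∈ range d, (m - a i) := by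
          have e1 : ∏ i ∈ range d, (-m + a i) = ∏ i ∈ range d, (-(m - a i)) :=
            Finset.prod_congr rfl fun n _ => by ring
          rw [e1, prod_range_neg, ← mul_assoc, ← pow_add, ← two_mul, pow_mul]
          norm_num
        rw [hsign]
        have hmain := top_lobe hgap ha0 hd B
        rw [← hm] at hmain
        refine lobe_finish (B := B) hd ?_ ?_ (tol_le hmpos.le hapos) hmain
        · exact Finset.prod_pos fun i hi => by
            have := hapos i (Finset.mem_range.mp hi); linarith
        · have h3 : (0 : ℝ) ≤ Real.exp ((B : ℝ) * (d : ℝ)) := (Real.exp_pos _).le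
          rw [hm]
          linarith

end MarginGeometry

/-! ## The registered stub: glue to the Buchstab–Dickman row -/

section Glue

open Polynomial
open Summit.Parity.GeneralizedHardyLittlewood.Cruxes.ModelHyperbolicity.WindowChainTransport
  (cellDensity modelPoly modelPoly_eval calc_pos)

/-- **`stub_lobeMarginOfZeroGeometry` (registered): zero geometry ⇒ lobe certificate.**  If for some `B`
and all large `u` the Buchstab–Dickman row factors as `modelPoly u = I_{u-1}(u) ∏_{i<u-2} (X + a_i)` with
`0 < a_0 ≤ B`, gaps `≥ 1` and non-decreasing, and `a_{u-3} ≤ e^{B(u-2)}` (`ModelZeroGeometry`), then the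
lobe certificate `ModelLobeMargin` holds, with `C = 6 + 3B`, `u₀ ∨ 3`, and the test points of
`MarginGeometry.margin_from_geometry` for `d = u - 2` (the common factor `I_{u-1}(u) = cellDensity (u-2) u > 0`
by `calc_pos`). -/
theorem stub_lobeMarginOfZeroGeometry : ModelZeroGeometry → ModelLobeMargin := by
  rintro ⟨B, u₀, hu₀⟩
  refine ⟨6 + 3 * (B : ℝ), by positivity, max u₀ 3, fun u hu => ?_⟩
  have hu₀u : u₀ ≤ u := le_of_max_le_left hu
  have h3u : 3 ≤ u := le_of_max_le_right hu
  obtain ⟨a, ha0, haB, hgap, hmono, htop, hfac⟩ := hu₀ u hu₀u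
  have e3 : u - 3 = u - 2 - 1 := by omega
  rw [e3] at htop
  set d := u - 2 with hd
  have hd1 : 1 ≤ d := by omega
  obtain ⟨x, hxmono, hxmargin⟩ := MarginGeometry.margin_from_geometry B d hd1 a ha0 haB hgap hmono htop
  refine ⟨x, fun k hk => hxmono k (by omega), fun k hk => ?_⟩
  have hm := hxmargin k (by omega)
  have heval : ∀ y : ℝ, ∑ j ∈ Finset.range u, cellDensity j u * y ^ j =
      cellDensity d u * ∏ i ∈ Finset.range d, (y + a i) := by
    intro y
    rw [← modelPoly_eval, hfac, eval_mul, eval_C, eval_prod]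
    simp only [eval_add, eval_X, eval_C]
  have hc : 0 < cellDensity d u := by
    refine calc_pos d u ?_
    have : ((d : ℕ) : ℝ) = (u : ℝ) - 2 := by
      rw [hd, Nat.cast_sub (by omega : 2 ≤ u)]
      norm_num
    rw [this]
    linarith
  have hu1 : u - 1 = d + 1 := by omega
  rw [heval, heval, hu1]
  have hexp : Real.exp (-((6 + 3 * (B : ℝ)) * u)) ≤ Real.exp (-((6 + 3 * (B : ℝ)) * d)) := by
    rw [Real.exp_le_exp]
    have hdu : (d : ℝ) ≤ u := by exact_mod_cast Nat.sub_le u 2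
    have hB0 : (0 : ℝ) ≤ B := Nat.cast_nonneg B
    nlinarith
  have hapos : ∀ i : ℕ, i < d → 0 < a i := fun i hi => MarginGeometry.a_pos hgap ha0 hi
  have hT : 0 ≤ (∏ i ∈ Finset.range d, (|x k| + a i)) + |x k| ^ (d + 1) :=
    add_nonneg (Finset.prod_nonneg fun i hi => by
      have := hapos i (Finset.mem_range.mp hi); positivity) (by positivity)
  calc Real.exp (-((6 + 3 * (B : ℝ)) * u)) *
        (cellDensity d u * ∏ i ∈ Finset.range d, (|x k| + a i) + cellDensity d u * |x k| ^ (d + 1))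
      = cellDensity d u * (Real.exp (-((6 + 3 * (B : ℝ)) * u)) *
          ((∏ i ∈ Finset.range d, (|x k| + a i)) + |x k| ^ (d + 1))) := by ring
    _ ≤ cellDensity d u * (Real.exp (-((6 + 3 * (B : ℝ)) * d)) *
          ((∏ i ∈ Finset.range d, (|x k| + a i)) + |x k| ^ (d + 1))) := by
        gcongr
    _ < cellDensity d u * ((-1) ^ k * ∏ i ∈ Finset.range d, (x k + a i)) :=
        mul_lt_mul_of_pos_left hm hc
    _ = (-1) ^ k * (cellDensity d u * ∏ i ∈ Finset.range d, (x k + a i)) := by ring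

end Glue

end Summit.Parity.GeneralizedHardyLittlewood.Cruxes.FibreHyperbolicityAlong.SiftedChowlaDistillation

end
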